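import Summits.Ventures.PercRepro0.ZhangSides

/-!
# P1 · HARRIS (Zhang's argument), part C: Lemma 1.4 and the limits `P_p(E_n) → P_p(∃ infinite cluster)`

Cell pub-perc-repro0, seat p2.  On the objects of `ZhangArms.lean` / `ZhangSides.lean`:

* Lemma 1.4: on `armPInf S n` (`S` finite) some vertex of `S` lies in an infinite cluster
  (`exists_connInf_of_armPInf`; pigeonhole over the scales `M`);
* `boxInf n ↑ existsInfCluster 2` and `dboxInf n ↑ existsInfCluster 2`, measurability, the limits
  `tendsto_P_boxInf` / `tendsto_P_dboxInf`, and the self-duality identity `P_half_dualBoxInf`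
  (`P_½(E*_n) = P_½(E_n')`, p1's `P_half_preimage_dualConfig`).
-/

open MeasureTheory ProbabilityTheory unitInterval
open scoped ENNReal Topology

namespace Summit.Ventures.PercRepro0.Zhang

open Summit.Ventures.PercRepro0.Defs Summit.Ventures.PercRepro0.L2 Summit.Ventures.PercRepro0.DualMap
  Summit.Ventures.PercRepro0.Crossing

-- BEGIN BODY

open Summit.Ventures.PercRepro0.L2 Summit.Ventures.PercRepro0.DualMap Summit.Ventures.PercRepro0.Crossing

/-! ### Lemma 1.4: on `A^S_n` some vertex of the finite side `S` percolates -/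

/-- An `OffAdj`-path is an open path. -/
lemma conn_of_offAdj {n : ℕ} {ω : Config 2} {u y : Vertex 2}
    (h : Relation.ReflTransGen (OffAdj n ω) u y) : Conn 2 ω u y :=
  (conn_iff_reflTransGen ω u y).2 (reflTransGen_mono (fun _ _ hab => ⟨hab.1, hab.2.1⟩) h)

/-- Lemma 1.4(a): on `armPInf S n` (`S` finite, on the ring) some `u ∈ S` has an infinite cluster. -/
lemma exists_connInf_of_armPInf {n : ℕ} {S : Set (Vertex 2)} (hS : S.Finite) {ω : Config 2}
    (h : ω ∈ armPInf S n) : ∃ u ∈ S, ConnInf 2 ω u := by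
  have hM : ∀ M : ℕ, ∃ u : S, ∃ y ∈ boundary 2 (M + n + 2),
      Relation.ReflTransGen (OffAdj n ω) u y := fun M => by
    have := Set.mem_iInter₂.1 h (M + n + 2) (by omega)
    obtain ⟨u, hu, y, hy, hpath⟩ := this
    exact ⟨⟨u, hu⟩, y, hy, hpath⟩
  choose f y hy hpath using hM
  haveI : Finite S := hS.to_subtype
  obtain ⟨u, hu⟩ := Finite.exists_infinite_fiber f
  refine ⟨u, u.2, ?_⟩
  haveI : Infinite (f ⁻¹' {u}) := hu
  refine Set.infinite_of_injective_forall_mem (f := fun M : f ⁻¹' {u} => y M) ?_ fun M => ?_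
  · intro M M' hMM'
    have h1 : nrm (y M) = M + n + 2 := (mem_boundary_iff_nrm (by omega)).1 (hy M)
    have h2 : nrm (y M') = M' + n + 2 := (mem_boundary_iff_nrm (by omega)).1 (hy M')
    apply Subtype.ext
    have : nrm (y M) = nrm (y M') := congrArg nrm hMM'
    omega
  · have hfM : f M = u := M.2
    have := hpath M
    rw [hfM] at this
    exact conn_of_offAdj this

/-! ### The limits `P_p(E_n) → P_p(∃ infinite cluster)` -/

/-- `boxInf` is monotone. -/
lemma boxInf_mono : Monotone boxInf := fun n m hnm ω hω => by
  obtain ⟨v, hv, hinf⟩ := hω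
  exact ⟨v, fun i => (hv i).trans (by exact_mod_cast hnm), hinf⟩

/-- `⋃ n, boxInf n = existsInfCluster 2`. -/
lemma iUnion_boxInf : ⋃ n, boxInf n = existsInfCluster 2 := by
  ext ω
  simp only [Set.mem_iUnion, boxInf, Set.mem_setOf_eq, existsInfCluster]
  constructor
  · rintro ⟨n, v, _, hv⟩; exact ⟨v, hv⟩
  · rintro ⟨v, hv⟩
    exact ⟨nrm v, v, fun i => by rw [Int.abs_eq_natAbs]; exact_mod_cast natAbs_le_nrm v i, hv⟩

/-- `boxInf n` is measurable. -/
lemma measurableSet_boxInf (n : ℕ) : MeasurableSet (boxInf n) := by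
  have : boxInf n = ⋃ v ∈ box 2 n, {ω | ConnInf 2 ω v} := by ext ω; simp [boxInf]
  rw [this]
  exact MeasurableSet.biUnion (Set.to_countable _) fun v _ => L2.measurableSet_connInf v

/-- `P_p(E_n) → P_p(∃ infinite cluster)`. -/
lemma tendsto_P_boxInf (p : I) :
    Filter.Tendsto (fun n => P 2 p (boxInf n)) Filter.atTop (𝓝 (P 2 p (existsInfCluster 2))) := by
  rw [← iUnion_boxInf]
  exact tendsto_measure_iUnion_atTop boxInf_mono

/-- `dboxInf` is monotone. -/
lemma dboxInf_mono : Monotone dboxInf := fun n m hnm ω hω => by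
  obtain ⟨v, hv, hinf⟩ := hω
  exact ⟨v, (show dn v ≤ n from hv).trans (by exact_mod_cast hnm), hinf⟩

/-- `⋃ n, dboxInf n = existsInfCluster 2`. -/
lemma iUnion_dboxInf : ⋃ n, dboxInf n = existsInfCluster 2 := by
  ext ω
  simp only [Set.mem_iUnion, dboxInf, Set.mem_setOf_eq, existsInfCluster]
  constructor
  · rintro ⟨n, v, _, hv⟩; exact ⟨v, hv⟩
  · rintro ⟨v, hv⟩
    refine ⟨(dn v).toNat, v, ?_, hv⟩
    show dn v ≤ ((dn v).toNat : ℤ)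
    exact Int.self_le_toNat _

/-- `dboxInf n` is measurable. -/
lemma measurableSet_dboxInf (n : ℕ) : MeasurableSet (dboxInf n) := by
  have : dboxInf n = ⋃ v ∈ dualBox n, {ω | ConnInf 2 ω v} := by ext ω; simp [dboxInf]
  rw [this]
  exact MeasurableSet.biUnion (Set.to_countable _) fun v _ => L2.measurableSet_connInf v

/-- `dualBoxInf n` is measurable. -/
lemma measurableSet_dualBoxInf (n : ℕ) : MeasurableSet (dualBoxInf n) :=
  measurable_dualConfig (measurableSet_dboxInf n)

/-- `P_{½}(E*_n) = P_{½}(E_n')` with `E_n'` the ψ-coordinate event (self-duality at `p = ½`). -/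
lemma P_half_dualBoxInf (n : ℕ) :
    P 2 (clamp (1 / 2)) (dualBoxInf n) = P 2 (clamp (1 / 2)) (dboxInf n) :=
  P_half_preimage_dualConfig (measurableSet_dboxInf n)

/-- `P_p(E_n') → P_p(∃ infinite cluster)`. -/
lemma tendsto_P_dboxInf (p : I) :
    Filter.Tendsto (fun n => P 2 p (dboxInf n)) Filter.atTop (𝓝 (P 2 p (existsInfCluster 2))) := by
  rw [← iUnion_dboxInf]
  exact tendsto_measure_iUnion_atTop dboxInf_mono

-- END BODY

end Summit.Ventures.PercRepro0.Zhang
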